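import Literature.AlgebraicGeometry.Frobenioids.DivisorMonoidExamplesBirat
import Literature.AlgebraicGeometry.Frobenioids.BaseIdentityPreStepsSlim
import HarnessLib

/-!
# Frobenioids I, §4: Remark 4.9.1 — the universal closure of the typed SCHEMA `Ex43.Remark491 B Supp`
# is REFUTED in the kernel (junk birationalization datum); the instance form is the tree's
# `Ex43.remark491_holds_at_birationalization`

Mochizuki, *The geometry of Frobenioids I: the general theory*, Kyushu J. Math. **62** (2008)
293–400, kurims text p. 90, Remark 4.9.1: "One verifies immediately that the Frobenioid of Example 4.3
is not of rational type" [cite: MochizukiFrdI2008, Rem. 4.9.1 p.90]; Def. 4.5 (ii) p. 86 (strictly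
rational / rational objects); Prop. 4.4 pp. 82–83 (the birationalization).

PROOF-ONLY companion (theorems only, no definitions) of `DivisorMonoidExamples.lean` (seat abc-iut-L1-t3:
the statement `Ex43.Remark491`), `DivisorMonoidExamplesProofs.lean` (`Ex43.remark491_of_isLocalization`)
and `DivisorMonoidExamplesBirat.lean` (`Ex43.exists_biratData`, `Ex43.remark491_holds_at_birationalization`);
cell abc-iut, FACT-LIST row F-1056 (class R5: "schema over an arbitrary Prop/predicate PARAMETER:
universal closure not a fact; named instances only"), seat abc-iut-f-037.

The typed statement `Ex43.Remark491 B Supp := ∃ a, ¬ IsRational B Supp a` is a SCHEMA over a free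
birationalization datum `B : Ex43.data.BiratData` — a data-only INTERFACE (Prop. 4.4) whose field
`phiBirat = Φ^birat ⊆ Φ^gp` is free data — and a free support predicate `Supp` (Def. 2.4 (i)(d), §2). This
file records the two kernel facts that place the row:

* `Ex43.exists_biratData_not_remark491` — there is a birationalization datum `B` of the Frobenioid of
  Ex. 4.3 whose functor `C → C^birat` IS a localisation at the co-angular pre-steps and which satisfies the
  typed Prop. 4.4 (i) and (ii), together with a support predicate `Supp`, for which `Remark491 B Supp` is
  FALSE: take THE localisation datum of `Ex43.exists_biratData` and replace only its rational function
  monoid by the junk value `Φ^birat := Φ^gp` (all of the Grothendieck group), and `Supp a 𝔭 := (a ≠ 0)`;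
  then `1 - 0 ∈ Φ^birat(A)` with `𝔭 ∈ Supp(1)`, `𝔭 ∉ Supp(0)` makes every object strictly rational, hence
  rational (the identity is a pull-back morphism, Rem. 1.2.1). So the hypothesis "Prop. 4.4 (iii)" (the exact
  sequence `1 → O^×(A) → O^×(A^birat) → Φ^birat(A) → 1`, which pins `Φ^birat` down) of
  `Ex43.remark491_of_isLocalization` cannot be dropped, and
* `Ex43.not_forall_remark491` — the universal closure `∀ B Supp, Remark491 B Supp` of the schema is false.

The printed content of Rem. 4.9.1 is untouched and PROVED in the tree at THE birationalization
(`Ex43.remark491_holds_at_birationalization`: for every localisation datum satisfying Prop. 4.4 (iii) and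
every `Supp`). Nothing of the paper is restated or contradicted: the refuted sentence is an artefact of
quantifying universally over a data-only interface. Nothing here bears on [IUTchIII] Cor. 3.12.
-/

namespace Literature.AlgebraicGeometry.Frobenioids

open CategoryTheory

namespace Ex43

/-- With the junk support predicate `Supp a 𝔭 := (a ≠ 1)` (multiplicative notation for `a ≠ 0`) and
`Φ^birat := ⊤`, every object of the category `C` of Ex. 4.3 is strictly rational (Def. 4.5 (ii)): the
witness pair is `a = 1 ∈ ℚ_{≥0}` (multiplicatively `ofAdd 1`), `b = 0`. Auxiliary for the refutation of
the universal closure of the schema `Remark491`. [cite: MochizukiFrdI2008, Def. 4.5 (ii) p.86] -/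
theorem isStrictlyRational_of_phiBirat_eq_top (B : data.BiratData) (hB : ∀ X, B.phiBirat X = ⊤)
    (A : Obj) :
    PreFrobenioidData.IsStrictlyRational B (fun {_} a _ => a ≠ 1) A := by
  intro 𝔭
  refine ⟨Multiplicative.ofAdd (1 : NNRat), 1, ?_, ?_, ?_⟩
  · rw [hB]; exact Subgroup.mem_top _
  · intro h
    have h0 : (Multiplicative.ofAdd (1 : NNRat) : Multiplicative NNRat) = 1 := h
    have h1 := congrArg Multiplicative.toAdd h0
    rw [toAdd_ofAdd, toAdd_one] at h1
    exact one_ne_zero h1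
  · exact fun h => h rfl

/-- **A birationalization datum of the Frobenioid of Ex. 4.3 at which the schema `Remark491` FAILS**
(for a suitable support predicate), although its functor `C → C^birat` is a localisation at the
co-angular pre-steps and the typed Prop. 4.4 (i), (ii) hold: THE localisation datum of
`exists_biratData` with the free field `Φ^birat` reset to `⊤` (so that Prop. 4.4 (iii) fails), and
`Supp a 𝔭 := (a ≠ 0)`. Every object is then rational (Def. 4.5 (ii); the identity is a pull-back
morphism). Shows that the Prop. 4.4 (iii) hypothesis of `remark491_of_isLocalization` is essential.
[cite: MochizukiFrdI2008, Rem. 4.9.1 p.90] -/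
theorem exists_biratData_not_remark491 :
    ∃ (B : PreFrobenioidData.BiratData.{0, 0, 0, 0, 0, 0} data)
      (Supp : ∀ {X : D}, data.Mon X → Primes (data.Mon X) → Prop),
      B.toBirat.IsLocalization data.IsCoAngularPreStep ∧ PreFrobenioidData.Prop44i B ∧
        PreFrobenioidData.Prop44ii B ∧ ¬ Remark491 B Supp := by
  obtain ⟨B, hL, h1, h2, -⟩ := exists_biratData
  refine ⟨{ B with phiBirat := fun _ => ⊤, divBirat_mem := fun _ _ => Subgroup.mem_top _ },
    fun {_} a _ => a ≠ 1, hL, h1, h2, ?_⟩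
  rintro ⟨a, ha⟩
  exact ha ⟨a, 𝟙 a, PreFrobenioidData.isPullbackMorphism_id data a,
    isStrictlyRational_of_phiBirat_eq_top _ (fun _ => rfl) a⟩

/-- **The universal closure of the typed schema `Ex43.Remark491 B Supp` is FALSE** (FACT-LIST row F-1056,
class R5: a schema over a free data-only interface and a free predicate is consumable at named instances
only). The printed Rem. 4.9.1 itself — "the Frobenioid of Example 4.3 is not of rational type" — is PROVED
in the tree at THE birationalization: `remark491_holds_at_birationalization`.
[cite: MochizukiFrdI2008, Rem. 4.9.1 p.90] -/
theorem not_forall_remark491 :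
    ¬ ∀ (B : PreFrobenioidData.BiratData.{0, 0, 0, 0, 0, 0} data)
        (Supp : ∀ {X : D}, data.Mon X → Primes (data.Mon X) → Prop), Remark491 B Supp := by
  obtain ⟨B, Supp, -, -, -, hnot⟩ := exists_biratData_not_remark491
  exact fun h => hnot (h B Supp)

end Ex43

end Literature.AlgebraicGeometry.Frobenioids
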